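import Summits.AtomisticToContinuum.Crystallization.Theorems.OverbindingBudgetAffinePlanarElementary
import Summits.AtomisticToContinuum.Crystallization.Theorems.OverbindingBudgetAffineFarWindow

/-!
# Overbinding budget, affine far-core cell (31280 Z2): ONE-SIDED truncations of the planar layer
# (decomp-a2c lens-4, generation 66, Deliverable I part 2 of 2 = memo NODE-g66 §13, item (T1b) planar kernel, structural half)

Imports g66 I1 `…PlanarElementary` (`planarT`, `planarT_succ_le`, `planarT_nonneg`; transitively H2 `layerSum_zero_zero_eq_lines`,
`summable_int_pair_norm_inv_pow`, `tsum_int_smul_line_zero`, tree `linearIndependent_map_pair`) and g66 G2 `…FarWindow`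
(`tsum_int_le_near_add_far`, `sum_range_pow_le_of_lt_one`).  Restates nothing.  PROVED, 0 sorry, standard axioms
(probe `TowerTreeG66I.lean`; pins `TowerTreeG66IPins.lean`; must-fail `TowerTreeG66IMustFail.lean`).

* §I3 `planarT_add_nat_le` — geometric envelope `planarT σ t (m₀+n) ≤ ρ^n planarT σ t m₀`, `ρ = ((m₀+1)/m₀)^{σ−1}e^{−2πt₀}`;
  ★★ `planar_mseries_encl` — for `σ ≥ 1`, `t ≥ t₀ > 0`, any phase `θ`, any cut `M` with `ρ = ((M+2)/(M+1))^{σ−1}e^{−2πt₀} < 1`: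
  `m ↦ cos(θm) planarT σ t |m|` is summable and `|Σ_{m∈ℤ} − Σ_{|m|≤M}| ≤ 4·planarT σ t (M+1)/(1−ρ)` (both one-sided forms;
  G2's split applied to the non-negative series `T`, `(1+cos)T`, `(1−cos)T`).
* §I4 `summable_lines`; ★ `sum_near_lines_le_layerSum` — `Σ_{|j|≤J} Σ_i ‖iBt₁+jBt₂‖^{−2σ} ≤ layerSum B (2σ) 0 0` (drop far lines:
  the LOWER bound of the `n = 12` planar layer needs no `j`-tail, no `ζ(11)`, no `ζ(12)`); `partial_zeta_le_line_zero`
  (`2(‖u‖²)^{−σ}Σ_{n<N} n^{−2σ} ≤` the `j = 0` line).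
What remains for the per-box planar kernel (memo §13): the UPPER `j`-tail for `σ = 3` (far-line majorant: main `(3π/8)(a/(|j|√D))⁵`,
`Σ_{|j|>J}` by `StackingSums.sum_inv_pow_Ioc_le`, Bessel part `≤ (1/Γσ)Σ_{m≠0} planarT ≤ planarT σ t_j 1·2/(1−ρ₁)`, geometric in `j`)
and the rational brackets (`π`: B1 `piLo/piHi`; `exp`: B1 `expUB` + `Real.add_one_le_exp` powers; `cos`: Mathlib `Real.cos` bounds after
period reduction; `√`: B1/C; `halfPolyQ` exact).
-/

noncomputable section

open MeasureTheory Set Module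
open scoped Real InnerProductSpace

namespace Summit.AtomisticToContinuum.Crystallization.Theorems.OverbindingBudgetAffineFarSmoothSplit
open Literature.MathematicalPhysics.StatisticalMechanics Literature.Algebra.EuclideanLattices Literature.Analysis.FunctionSpaces

-- PRIVATE copy (landing lane, critic row 1143): `sum_range_pow_le_of_lt_one` is `private` in the tree `…FarWindow` (dedup gate), so this consumer carries its own copy.
/-- Bounded partial sums of a geometric series `Σ Q^m ≤ 1/(1−Q)` (`0 ≤ Q < 1`). [folklore] (dedup gate: public twins (HolmgrenBoyleLind.hbl_Gamma_three/six, Literature.Barriers.NavierStokesRegularity.Dyadic.geom_sum_le_inv) live in unrelated modules; kept PRIVATE here) -/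
private theorem sum_range_pow_le_of_lt_one {Q : ℝ} (hQ0 : 0 ≤ Q) (hQ1 : Q < 1) (N : ℕ) :
    ∑ m ∈ Finset.range N, Q ^ m ≤ 1 / (1 - Q) := by
  rw [one_div, ← tsum_geometric_of_lt_one hQ0 hQ1]
  exact (summable_geometric_of_lt_one hQ0 hQ1).sum_le_tsum _ fun n _ => pow_nonneg hQ0 n

local notation "E3" => EuclideanSpace ℝ (Fin 3)

/-! ## §I3 One-sided truncation of the `m`-series of a planar line (geometric envelope + G2's ℤ-sum split) -/

section MSeries

/-- Geometric envelope of the planar terms: for `m₀ ≥ 1`, `t ≥ t₀ > 0`, `σ ≥ 1` and every `n`,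
`planarT σ t (m₀ + n) ≤ ρ^n · planarT σ t m₀`, `ρ = ((m₀+1)/m₀)^{σ−1} e^{−2πt₀}`. [this file] -/
theorem planarT_add_nat_le (σ : ℕ) (hσ : 1 ≤ σ) {t t₀ m₀ : ℝ} (ht₀ : 0 < t₀) (ht : t₀ ≤ t) (hm₀ : 1 ≤ m₀) (n : ℕ) :
    planarT σ t (m₀ + n) ≤ (((m₀ + 1) / m₀) ^ (σ - 1) * Real.exp (-(2 * π * t₀))) ^ n * planarT σ t m₀ := by
  induction n with
  | zero => simp
  | succ n ih =>
    have hm0 : 0 < m₀ := by linarith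
    have hm : 1 ≤ m₀ + n := le_add_of_le_of_nonneg hm₀ n.cast_nonneg
    have step := planarT_succ_le σ hσ ht₀ ht hm
    have hratio : ((m₀ + n + 1) / (m₀ + n)) ^ (σ - 1) ≤ ((m₀ + 1) / m₀) ^ (σ - 1) := by
      apply pow_le_pow_left₀ (by positivity)
      rw [div_le_div_iff₀ (by positivity) hm0]
      nlinarith [n.cast_nonneg (α := ℝ)]
    have hT0 : 0 ≤ planarT σ t m₀ := planarT_nonneg σ (ht₀.trans_le ht) hm0.le
    have hρ0 : 0 ≤ ((m₀ + 1) / m₀) ^ (σ - 1) * Real.exp (-(2 * π * t₀)) := by positivity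
    calc planarT σ t (m₀ + ((n + 1 : ℕ) : ℝ)) = planarT σ t (m₀ + n + 1) := by rw [Nat.cast_succ, ← add_assoc]
      _ ≤ ((m₀ + n + 1) / (m₀ + n)) ^ (σ - 1) * Real.exp (-(2 * π * t₀)) * planarT σ t (m₀ + n) := step
      _ ≤ ((m₀ + 1) / m₀) ^ (σ - 1) * Real.exp (-(2 * π * t₀)) *
            ((((m₀ + 1) / m₀) ^ (σ - 1) * Real.exp (-(2 * π * t₀))) ^ n * planarT σ t m₀) := by
          have h0 : 0 ≤ planarT σ t (m₀ + n) := planarT_nonneg σ (ht₀.trans_le ht) (by positivity)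
          gcongr
      _ = (((m₀ + 1) / m₀) ^ (σ - 1) * Real.exp (-(2 * π * t₀))) ^ (n + 1) * planarT σ t m₀ := by ring

/-- ★★ **Two-sided truncation of the `m`-series of a planar line.**  For `σ ≥ 1`, `t ≥ t₀ > 0`, any phase `θ`, any cut `M`,
with `P = planarT σ t (M+1)` and `ρ = ((M+2)/(M+1))^{σ−1} e^{−2πt₀} < 1`: the series `m ↦ cos(θm)·planarT σ t |m|` is summable and
`|Σ_{m∈ℤ} cos(θm) planarT σ t |m| − Σ_{|m| ≤ M} cos(θm) planarT σ t |m|| ≤ 4P/(1−ρ)`.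
(G2's `tsum_int_le_near_add_far` applied to the NON-NEGATIVE series `T`, `(1+cos)T`, `(1−cos)T`.) [this file] -/
theorem planar_mseries_encl (σ : ℕ) (hσ : 1 ≤ σ) {t t₀ : ℝ} (ht₀ : 0 < t₀) (ht : t₀ ≤ t) (θ : ℝ) (M : ℕ)
    (hρ : ((((M + 1 : ℕ) : ℝ) + 1) / ((M + 1 : ℕ) : ℝ)) ^ (σ - 1) * Real.exp (-(2 * π * t₀)) < 1) :
    Summable (fun m : ℤ => Real.cos (θ * m) * planarT σ t |(m : ℝ)|) ∧
    ∑ m ∈ Finset.Ioo (-((M + 1 : ℕ) : ℤ)) (M + 1 : ℕ), Real.cos (θ * m) * planarT σ t |(m : ℝ)| -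
        4 * planarT σ t ((M + 1 : ℕ) : ℝ) /
          (1 - ((((M + 1 : ℕ) : ℝ) + 1) / ((M + 1 : ℕ) : ℝ)) ^ (σ - 1) * Real.exp (-(2 * π * t₀))) ≤
      ∑' m : ℤ, Real.cos (θ * m) * planarT σ t |(m : ℝ)| ∧
    ∑' m : ℤ, Real.cos (θ * m) * planarT σ t |(m : ℝ)| ≤
      ∑ m ∈ Finset.Ioo (-((M + 1 : ℕ) : ℤ)) (M + 1 : ℕ), Real.cos (θ * m) * planarT σ t |(m : ℝ)| +
        4 * planarT σ t ((M + 1 : ℕ) : ℝ) /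
          (1 - ((((M + 1 : ℕ) : ℝ) + 1) / ((M + 1 : ℕ) : ℝ)) ^ (σ - 1) * Real.exp (-(2 * π * t₀))) := by
  set ρ : ℝ := ((((M + 1 : ℕ) : ℝ) + 1) / ((M + 1 : ℕ) : ℝ)) ^ (σ - 1) * Real.exp (-(2 * π * t₀)) with hρdef
  set P : ℝ := planarT σ t ((M + 1 : ℕ) : ℝ) with hPdef
  have htp : 0 < t := ht₀.trans_le ht
  have hρ0 : 0 ≤ ρ := by positivity
  have hP0 : 0 ≤ P := planarT_nonneg σ htp (by positivity)
  have hK : 1 ≤ M + 1 := by omega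
  -- the far majorant `u n = c ρ^n P` and its partial sums
  have hU : ∀ (c : ℝ), 0 ≤ c → ∀ N, ∑ m ∈ Finset.range N, c * (ρ ^ m * P) ≤ c * (P / (1 - ρ)) := by
    intro c hc N
    rw [← Finset.mul_sum]
    refine mul_le_mul_of_nonneg_left ?_ hc
    calc ∑ m ∈ Finset.range N, ρ ^ m * P = (∑ m ∈ Finset.range N, ρ ^ m) * P := by rw [Finset.sum_mul]
      _ ≤ 1 / (1 - ρ) * P := mul_le_mul_of_nonneg_right (sum_range_pow_le_of_lt_one hρ0 hρ N) hP0
      _ = P / (1 - ρ) := by ring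
  -- the geometric envelope on the far range
  have hfarT : ∀ k : ℤ, ((M + 1 : ℕ) : ℤ) ≤ |k| → planarT σ t |(k : ℝ)| ≤ ρ ^ (k.natAbs - (M + 1)) * P := by
    intro k hk
    have hk' : M + 1 ≤ k.natAbs := by
      have h := hk; rw [Int.abs_eq_natAbs] at h; exact_mod_cast h
    have hcast : |(k : ℝ)| = ((M + 1 : ℕ) : ℝ) + ((k.natAbs - (M + 1) : ℕ) : ℝ) := by
      rw [← Int.cast_abs, Int.abs_eq_natAbs, Int.cast_natCast, ← Nat.cast_add, Nat.add_sub_cancel' hk']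
    rw [hcast]
    exact planarT_add_nat_le σ hσ ht₀ ht (by simp) _
  have hcosle : ∀ k : ℤ, |Real.cos (θ * k)| ≤ 1 := fun k => Real.abs_cos_le_one _
  have hT0 : ∀ k : ℤ, 0 ≤ planarT σ t |(k : ℝ)| := fun k => planarT_nonneg σ htp (abs_nonneg _)
  -- (1) the non-negative series T
  obtain ⟨hsT, -⟩ := tsum_int_le_near_add_far (f := fun m : ℤ => planarT σ t |(m : ℝ)|) hT0 hK
    (u := fun n => 1 * (ρ ^ n * P)) (fun n => by positivity)
    (fun k hk => by simpa only [one_mul] using hfarT k hk) (hU 1 zero_le_one)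
  -- (2) φ = (1 + cos) T
  obtain ⟨hsφ, hφ⟩ := tsum_int_le_near_add_far (f := fun m : ℤ => (1 + Real.cos (θ * m)) * planarT σ t |(m : ℝ)|)
    (fun k => mul_nonneg (by linarith [(abs_le.mp (hcosle k)).1]) (hT0 k)) hK
    (u := fun n => 2 * (ρ ^ n * P)) (fun n => by positivity)
    (fun k hk => by
      have h1 : 1 + Real.cos (θ * k) ≤ 2 := by linarith [(abs_le.mp (hcosle k)).2]
      exact (mul_le_mul h1 (hfarT k hk) (hT0 k) zero_le_two)) (hU 2 zero_le_two)
  -- (3) ψ = (1 − cos) T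
  obtain ⟨hsψ, hψ⟩ := tsum_int_le_near_add_far (f := fun m : ℤ => (1 - Real.cos (θ * m)) * planarT σ t |(m : ℝ)|)
    (fun k => mul_nonneg (by linarith [(abs_le.mp (hcosle k)).2]) (hT0 k)) hK
    (u := fun n => 2 * (ρ ^ n * P)) (fun n => by positivity)
    (fun k hk => by
      have h1 : 1 - Real.cos (θ * k) ≤ 2 := by linarith [(abs_le.mp (hcosle k)).1]
      exact (mul_le_mul h1 (hfarT k hk) (hT0 k) zero_le_two)) (hU 2 zero_le_two)
  have hnearT : ∑ m ∈ Finset.Ioo (-((M + 1 : ℕ) : ℤ)) (M + 1 : ℕ), planarT σ t |(m : ℝ)| ≤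
      ∑' m : ℤ, planarT σ t |(m : ℝ)| := hsT.sum_le_tsum _ fun m _ => hT0 m
  have hsum_cos : Summable (fun m : ℤ => Real.cos (θ * m) * planarT σ t |(m : ℝ)|) := by
    refine (hsφ.sub hsT).congr fun m => ?_
    ring
  refine ⟨hsum_cos, ?_, ?_⟩
  · -- lower: Σ cosT = ΣT − Σψ
    have hdec : ∑' m : ℤ, Real.cos (θ * m) * planarT σ t |(m : ℝ)| =
        ∑' m : ℤ, planarT σ t |(m : ℝ)| - ∑' m : ℤ, (1 - Real.cos (θ * m)) * planarT σ t |(m : ℝ)| := by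
      rw [← hsT.tsum_sub hsψ]; refine tsum_congr fun m => ?_; ring
    have hnear : ∑ m ∈ Finset.Ioo (-((M + 1 : ℕ) : ℤ)) (M + 1 : ℕ), Real.cos (θ * m) * planarT σ t |(m : ℝ)| =
        ∑ m ∈ Finset.Ioo (-((M + 1 : ℕ) : ℤ)) (M + 1 : ℕ), planarT σ t |(m : ℝ)| -
          ∑ m ∈ Finset.Ioo (-((M + 1 : ℕ) : ℤ)) (M + 1 : ℕ), (1 - Real.cos (θ * m)) * planarT σ t |(m : ℝ)| := by
      rw [← Finset.sum_sub_distrib]; refine Finset.sum_congr rfl fun m _ => ?_; ring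
    rw [hdec, hnear]
    have e : (2 : ℝ) * (2 * (P / (1 - ρ))) = 4 * P / (1 - ρ) := by ring
    linarith
  · -- upper: Σ cosT = Σφ − ΣT
    have hdec : ∑' m : ℤ, Real.cos (θ * m) * planarT σ t |(m : ℝ)| =
        ∑' m : ℤ, (1 + Real.cos (θ * m)) * planarT σ t |(m : ℝ)| - ∑' m : ℤ, planarT σ t |(m : ℝ)| := by
      rw [← hsφ.tsum_sub hsT]; refine tsum_congr fun m => ?_; ring
    have hnear : ∑ m ∈ Finset.Ioo (-((M + 1 : ℕ) : ℤ)) (M + 1 : ℕ), Real.cos (θ * m) * planarT σ t |(m : ℝ)| =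
        ∑ m ∈ Finset.Ioo (-((M + 1 : ℕ) : ℤ)) (M + 1 : ℕ), (1 + Real.cos (θ * m)) * planarT σ t |(m : ℝ)| -
          ∑ m ∈ Finset.Ioo (-((M + 1 : ℕ) : ℤ)) (M + 1 : ℕ), planarT σ t |(m : ℝ)| := by
      rw [← Finset.sum_sub_distrib]; refine Finset.sum_congr rfl fun m _ => ?_; ring
    rw [hdec, hnear]
    have e : (2 : ℝ) * (2 * (P / (1 - ρ))) = 4 * P / (1 - ρ) := by ring
    linarith

end MSeries

/-! ## §I4 Dropping far lines: the near lines bound the planar layer from BELOW (the `n = 12` side needs nothing else) -/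

section NearLines

variable {E : Type*} [NormedAddCommGroup E] [InnerProductSpace ℝ E] [FiniteDimensional ℝ E]

/-- The family of LINES `j ↦ Σ_i ‖iu + jv‖^{−2σ}` is summable and each line is `≥ 0` (independent `u, v`, `σ ≥ 2`). [this file] -/
theorem summable_lines {u v : E} (huv : LinearIndependent ℝ ![u, v]) (σ : ℕ) (hσ : 2 ≤ σ) :
    Summable fun j : ℤ => ∑' i : ℤ, ((‖(i : ℝ) • u + (j : ℝ) • v‖ ^ 2) ^ σ)⁻¹ := by
  have hs := summable_int_pair_norm_inv_pow huv (2 * σ) (by omega)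
  have hs' : Summable fun ij : ℤ × ℤ => ((‖(ij.1 : ℝ) • u + (ij.2 : ℝ) • v‖ ^ 2) ^ σ)⁻¹ := by
    refine hs.congr fun ij => ?_
    rw [← pow_mul, inv_pow]
  have hs'' : Summable fun ji : ℤ × ℤ => ((‖(ji.2 : ℝ) • u + (ji.1 : ℝ) • v‖ ^ 2) ^ σ)⁻¹ :=
    (Equiv.prodComm ℤ ℤ).summable_iff.2 hs'
  exact hs''.prod

/-- ★ **Near lines from below**: for injective `B`, `σ ≥ 2` and any cut `J`,
`Σ_{|j| ≤ J} Σ_{i∈ℤ} ‖iBt₁ + jBt₂‖^{−2σ} ≤ layerSum B (2σ) 0 0` — every dropped line is a sum of non-negative terms.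
(The LOWER bound of the `n = 12` planar layer needs no `j`-tail and no `ζ(11)`.) [this file] -/
theorem sum_near_lines_le_layerSum (B : E3 →ₗ[ℝ] E3) (hB : Function.Injective B) (σ : ℕ) (hσ : 2 ≤ σ) (J : ℕ) :
    ∑ j ∈ Finset.Ioo (-((J + 1 : ℕ) : ℤ)) (J + 1 : ℕ),
        ∑' i : ℤ, ((‖(i : ℝ) • B (triangularVec₁ 1) + (j : ℝ) • B (triangularVec₂ 1)‖ ^ 2) ^ σ)⁻¹ ≤
      layerSum B (2 * σ) 0 0 := by
  rw [(layerSum_zero_zero_eq_lines B hB σ hσ).2]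
  exact (summable_lines (linearIndependent_map_pair B hB) σ hσ).sum_le_tsum _ fun j _ =>
    tsum_nonneg fun i => by positivity

omit [FiniteDimensional ℝ E] in
/-- The `j = 0` line from below by a partial `ζ(2σ)` sum: `2(‖u‖²)^{−σ} Σ_{n<N} n^{−2σ} ≤ Σ_{i∈ℤ} ‖iu + 0·v‖^{−2σ}`. [this file] -/
theorem partial_zeta_le_line_zero (σ : ℕ) (hσ : 1 ≤ σ) (u v : E) (N : ℕ) :
    ((‖u‖ ^ 2) ^ σ)⁻¹ * (2 * ∑ n ∈ Finset.range N, 1 / (n : ℝ) ^ (2 * σ)) ≤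
      ∑' i : ℤ, ((‖(i : ℝ) • u + ((0 : ℤ) : ℝ) • v‖ ^ 2) ^ σ)⁻¹ := by
  have hζ : Summable fun n : ℕ => 1 / (n : ℝ) ^ (2 * σ) :=
    Real.summable_one_div_nat_pow.2 (by omega)
  obtain ⟨S, hS⟩ := hζ
  have hle : ∑ n ∈ Finset.range N, 1 / (n : ℝ) ^ (2 * σ) ≤ S :=
    hS.summable.sum_le_tsum _ (fun n _ => by positivity) |>.trans_eq hS.tsum_eq
  have h0 := tsum_int_smul_line_zero σ hσ u hS
  have e : ∑' i : ℤ, ((‖(i : ℝ) • u + ((0 : ℤ) : ℝ) • v‖ ^ 2) ^ σ)⁻¹ =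
      ∑' i : ℤ, ((‖(i : ℝ) • u + ((0 : ℤ) : ℝ) • u‖ ^ 2) ^ σ)⁻¹ := by
    refine tsum_congr fun i => ?_; simp
  rw [e, h0]
  have : 0 ≤ ((‖u‖ ^ 2) ^ σ)⁻¹ := by positivity
  gcongr

end NearLines

end Summit.AtomisticToContinuum.Crystallization.Theorems.OverbindingBudgetAffineFarSmoothSplit

end
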